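import Mathlib.LinearAlgebra.QuadraticForm.Basic
import Mathlib.LinearAlgebra.QuadraticForm.Prod
import Mathlib.LinearAlgebra.BilinearForm.Orthogonal
import Mathlib.Data.Set.Card
import Mathlib.Data.ZMod.Basic
import Literature.LinearAlgebra.QuadraticForm.ArfInvariant
import Literature.LinearAlgebra.QuadraticForm.MetabolicSpaces
import HarnessLib

/-!
# The inner-product quadratic space `(𝔽₂^{2k}, IP_k)` = Kirby's `⊕ᵏ H⁰'⁰`

Trunk: linear algebra / quadratic forms over `𝔽₂` (feeds T-CPLX-META lifting statements that
sort the points of `𝔽₂^{2k}` by the value of the inner-product gadget).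

The quadratic form `IP_k(x₁,y₁,…,x_k,y_k) = Σᵢ xᵢyᵢ` on `𝔽₂^{2k}` is, as a quadratic space, the
orthogonal sum of `k` hyperbolic planes `H⁰'⁰` (Kirby, *The Topology of 4-Manifolds*, LNM 1374,
Appendix pp. 102–103: "`⊕ⁿ H⁰'⁰` … `q` is zero on `2^{2n-1} + 2^{n-1}` elements"); as a Boolean
function it is the inner-product function `IP_n(x, y) = Σ xᵢyᵢ mod 2` of communication complexity
(Kushilevitz–Nisan 1996, Example 1.26 / §3; Rao–Yehudayoff 2020, Ch. 1 and Ch. 8 (lifting with the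
inner-product gadget)). Its polar form is the standard symplectic form `Σᵢ (xᵢy'ᵢ + x'ᵢyᵢ)`.

This file only NAMES the objects that statements about unions of perps / affine flats sorted by
`IP`-value quantify over, and records Kirby's point count:

* `IPVec k` — the carrier `Fin k → 𝔽₂ × 𝔽₂`; `ipForm k : QuadraticForm (ZMod 2) (IPVec k)` —
  `QuadraticMap.pi (fun _ => H00)`;
* `ipPerp k H` — the orthogonal complement of a subspace for the polar (symplectic) form;
* `ipCount k U a` — the number of points of a set `U ⊆ 𝔽₂^{2k}` with `IP_k = a` (`Set.ncard`);
* `nondegenerate_ipForm`, `arfInvariant_ipForm` (`= 0`), `card_zeros_ipForm`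
  (`#{IP_k = 0} = 2^{2k-1} + 2^{k-1}`, Kirby's count, from `ArfInvariant.lean`).
-/

namespace Literature.LinearAlgebra.QuadraticForm

open QuadraticMap Module

/-- The carrier `𝔽₂^{2k}` written as `k` coordinate pairs `(xᵢ, yᵢ)`. [cite: Kirby1989, Appendix p. 103] -/
abbrev IPVec (k : ℕ) : Type := Fin k → ZMod 2 × ZMod 2

/-- **The inner-product quadratic form** `IP_k(x, y) = Σᵢ xᵢ yᵢ` on `𝔽₂^{2k}`, i.e. Kirby's
`⊕ᵏ H⁰'⁰`. [cite: Kirby1989, Appendix p. 103] [cite: KushilevitzNisan1996, Example 1.26] -/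
def ipForm (k : ℕ) : QuadraticForm (ZMod 2) (IPVec k) :=
  QuadraticMap.pi fun _ : Fin k => H00

/-- `IP_k(v) = Σᵢ vᵢ.1 * vᵢ.2`. [cite: KushilevitzNisan1996, Example 1.26] -/
theorem ipForm_apply (k : ℕ) (v : IPVec k) : ipForm k v = ∑ i, (v i).1 * (v i).2 := by
  simp [ipForm, QuadraticMap.pi_apply, H00, linMulLin_apply]

/-- The orthogonal complement `H^⊥` of a subspace of `𝔽₂^{2k}` for the polar (symplectic) form of
`IP_k`. [cite: Kirby1989, Appendix p. 102] -/
abbrev ipPerp (k : ℕ) (H : Submodule (ZMod 2) (IPVec k)) : Submodule (ZMod 2) (IPVec k) :=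
  (polarForm (ipForm k)).orthogonal H

/-- The number of points of `U ⊆ 𝔽₂^{2k}` on which `IP_k` takes the value `a` (the two
"`IP`-classes" of `U`). [cite: Kirby1989, Appendix p. 103] -/
noncomputable def ipCount (k : ℕ) (U : Set (IPVec k)) (a : ZMod 2) : ℕ :=
  (U ∩ {v | ipForm k v = a}).ncard

/-- `ipCount` is monotone in the set. [folklore] -/
theorem ipCount_mono (k : ℕ) {U U' : Set (IPVec k)} (h : U ⊆ U') (a : ZMod 2) :
    ipCount k U a ≤ ipCount k U' a :=
  Set.ncard_le_ncard (Set.inter_subset_inter_left _ h) (Set.toFinite _)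

/-- The two `IP`-classes partition a set: `#U = #(U ∩ {IP = 0}) + #(U ∩ {IP = 1})`. [folklore] -/
theorem ipCount_zero_add_ipCount_one (k : ℕ) (U : Set (IPVec k)) :
    ipCount k U 0 + ipCount k U 1 = U.ncard := by
  classical
  unfold ipCount
  have h01 : ∀ a : ZMod 2, a = 0 ∨ a = 1 := by decide
  have hdisj : Disjoint (U ∩ {v | ipForm k v = 0}) (U ∩ {v | ipForm k v = 1}) := by
    rw [Set.disjoint_left]
    rintro v ⟨-, hv0⟩ ⟨-, hv1⟩
    simp only [Set.mem_setOf_eq] at hv0 hv1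
    rw [hv0] at hv1
    exact zero_ne_one hv1
  rw [← Set.ncard_union_eq hdisj (Set.toFinite _) (Set.toFinite _)]
  congr 1
  ext v
  simp only [Set.mem_union, Set.mem_inter_iff, Set.mem_setOf_eq]
  constructor
  · rintro (⟨h, -⟩ | ⟨h, -⟩) <;> exact h
  · intro h
    rcases h01 (ipForm k v) with h0 | h1
    · exact Or.inl ⟨h, h0⟩
    · exact Or.inr ⟨h, h1⟩

/-- The polar form of `IP_k` is nondegenerate (it is the standard symplectic form).
[cite: Kirby1989, Appendix p. 102] -/
theorem nondegenerate_ipForm (k : ℕ) : (polarBilin (ipForm k)).Nondegenerate :=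
  nondegenerate_pi fun _ => nondegenerate_H00

/-- `Arf(IP_k) = 0`. [cite: Kirby1989, Appendix p. 103] -/
theorem arfInvariant_ipForm (k : ℕ) : arfInvariant (ipForm k) = 0 :=
  arfInvariant_pi_H00 k

/-- **Kirby's count**: `IP_k` vanishes on exactly `2^{2k-1} + 2^{k-1}` of the `2^{2k}` points
(`k ≥ 1`). [cite: Kirby1989, Appendix p. 103] -/
theorem card_zeros_ipForm (k : ℕ) (hk : 0 < k) :
    Nat.card {v : IPVec k // ipForm k v = 0} = 2 ^ (2 * k - 1) + 2 ^ (k - 1) :=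
  card_zeros_eq_of_arfInvariant_eq_zero _ (nondegenerate_ipForm k) (finrank_pi_plane k) hk
    (arfInvariant_ipForm k)

/-- Kirby's count in `ipCount` form: the zero class of the whole space. [cite: Kirby1989, Appendix p. 103] -/
theorem ipCount_univ_zero (k : ℕ) (hk : 0 < k) :
    ipCount k Set.univ 0 = 2 ^ (2 * k - 1) + 2 ^ (k - 1) := by
  rw [ipCount, Set.univ_inter, ← card_zeros_ipForm k hk, ← Nat.card_coe_set_eq]
  rfl

/-- The one class of the whole space: `#{IP_k = 1} = 2^{2k-1} - 2^{k-1}` (`k ≥ 1`).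
[cite: Kirby1989, Appendix p. 103] -/
theorem ipCount_univ_one (k : ℕ) (hk : 0 < k) :
    ipCount k Set.univ 1 = 2 ^ (2 * k - 1) - 2 ^ (k - 1) := by
  have h := ipCount_zero_add_ipCount_one k Set.univ
  have hcard : (Set.univ : Set (IPVec k)).ncard = 4 ^ k := by
    rw [Set.ncard_univ, Nat.card_eq_fintype_card, Fintype.card_fun, Fintype.card_prod, ZMod.card,
      Fintype.card_fin]
  obtain ⟨m, rfl⟩ : ∃ m, k = m + 1 := ⟨k - 1, by omega⟩
  have e1 : 2 * (m + 1) - 1 = 2 * m + 1 := by omega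
  have e2 : m + 1 - 1 = m := by omega
  rw [ipCount_univ_zero _ hk, hcard, e1, e2] at h
  rw [e1, e2]
  have h4 : (4 : ℕ) ^ (m + 1) = 2 * 2 ^ (2 * m + 1) := by
    have : (4 : ℕ) = 2 ^ 2 := by norm_num
    rw [this, ← pow_mul, show 2 * (m + 1) = (2 * m + 1) + 1 by ring, pow_succ]; ring
  have hle : 2 ^ m ≤ 2 ^ (2 * m + 1) := Nat.pow_le_pow_right (by norm_num) (by omega)
  omega

end Literature.LinearAlgebra.QuadraticForm
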